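/-
Origin: expansion seat `planner-pub-hodgecm-pv14-g5-0`, handover import Pv14g5.WeilThetaModelHeisenbergPs -> HodgeCM.Automorphic.WeilThetaModelHeisenbergPs ; v3 DOC-ONLY whole-file replacement of RUN 28 row 79ff31a1 (same path/target/order: after WeilThetaModelHeisenbergPs) (`HOME/pub-hodgecm-pv14-g5/lean/Pv14g5/WeilThetaModelHeisenbergRelations.lean`, md5 f3130870, 247 lines);
landed by the gen-8 packager in gate run 29 REPLACES the earlier landed copy of `HodgeCM/Automorphic/WeilThetaModelHeisenbergRelations.lean` (import ^import Pv14g5\.→import HodgeCM.Automorphic. ×1).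
-/
/-
Origin: HOME/pub-hodgecm-pv14-g5/lean/Pv14g5/WeilThetaModelHeisenbergRelations.lean — session planner-pub-hodgecm-pv14-g5-0
(unit pub-hodgecm-pv14-g5, DAG-node prover #14 gen 5).  Intended final place:
`HodgeCM/Automorphic/WeilThetaModelHeisenbergRelations.lean` (namespace `HodgeCM.SchwartzWeil`).
PACKAGER: rewrite `import Pv14g5.WeilThetaModelHeisenbergPs` to `import HodgeCM.Automorphic.WeilThetaModelHeisenbergPs`
(this seat's HANDOVER #12).
Asserts nothing (no `axiom`, no new constants).
-/
import Summits.HodgeConjecture.HodgeCM.Automorphic.WeilThetaModelHeisenbergPs_2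

/-!
# Relations that hold in the Schwartz model: `σ⁴ = 1`, `[σ², u] = 1` — and what is not claimed

File #12 made the FREE group `F⟨σ,u⟩` act (`σ ↦ 𝓕`, `u ↦ T_m` on `𝓢(V, ℂ)`; `σ ↦ weylAut m`, `u ↦ u_2` on
`Heis V`).  On `V ⊕ V` (columns `(a; b)`) the two automorphisms are the symplectic matrices
`S_m = (0 m; -m⁻¹ 0)` (#6 `weyl`: `(a, b) ↦ (m b, -m⁻¹ a)`) and `U = (1 0; 2 1)` (`u_2`: `(a, b) ↦ (a, b + 2a)`),
which satisfy `S_m² = -1` (central) and `S_m⁴ = 1`.  Here we prove, as kernel theorems, that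
these two families of relations hold on BOTH sides of the model, so that the construction of #12 factors
through `F⟨σ,u⟩ / ⟪σ⁴, [σ², u]⟫`:

* `fourier_fourier_eq_parityCLM : 𝓕(𝓕Φ) = Φ(-·)` (`𝓕² = P`, the parity operator), hence
  `fourier_fourier_fourier_fourier : 𝓕⁴ = id`, `fourierUnit_pow_four`, `psRep_weylPowFour : π(σ⁴) = 1`;
* `parityCLM_chirpCLM : P ∘ T_c = T_c ∘ P`, hence `fourierUnit_sq_chirpUnit_comm` and
  `psRep_commWeylSqUnip : π([σ², u]) = 1`;
* on the Heisenberg side `Heis.weylAut_pow_four : σ⁴ = 1` (from #6 `weyl_weyl`),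
  `Heis.weylAut_sq_unip_comm : [σ², u_t] = 1` (`σ² = (a,b,u) ↦ (-a,-b,u)` commutes with every `u_t`), hence
  `Heis.psAction_weylPowFour : ψ(σ⁴) = 1`, `Heis.psAction_commWeylSqUnip : ψ([σ², u]) = 1`;
* consequently the normal closure `psRelations = ⟪σ⁴, [σ², u]⟫` lies in `ker π ∩ ker ψ`
  (`psRelations_le_ker_psRep`, `psRelations_le_ker_psAction`) and its words act trivially in the model
  (`repP_inr_eq_one_of_mem_psRelations`, `repP_mul_inr_of_mem_psRelations`);
* PROJECTIVE SHADOW of every relation: a word acting trivially on `Heis V` acts on `𝓢(V, ℂ)` inside the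
  commutant of `ρ_m(Heis V)` (`psRep_comm_repUnits_of_psAction_eq_one`, `psRep_comm_repCLM_of_mem_ker_psAction`).

NOT CLAIMED HERE (honest scope).  Whether `⟪σ⁴, [σ², u]⟫` is ALL of `ker ψ` — i.e. whether `⟨S_m, U⟩` is
PRESENTED by these two relations — is not proved in this file.  (Matrix remarks, informal: `S_m U S_m⁻¹ =
(1 -2m²; 0 1)`, so `⟨U, S_m U S_m⁻¹⟩` is a pair of opposite unipotents with product of entries `4m² ≥ 4`, free of
rank two by the ping-pong lemma for every `m ≠ 0`; `S_m U` has trace `2m`, unipotent-like for `m = ±1` and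
hyperbolic for `|m| ≥ 2` — the elliptic elements of `SL₂(ℤ)` on which Weil's index [We64, nos. 13–14] is visible
do not occur in `⟨S_m, U⟩`.  A kernel proof of `ker ψ = ⟪σ⁴, [σ², u]⟫` along these lines is deferred to a later
file.)  In general a relation of `⟨S_m, U⟩` is only known here to act inside the commutant of `ρ_m(Heis V)`
(previous bullet); so what the chain #5–#12 (+ this file) constructs is a genuine representation of
`Heis V ⋊ (F⟨σ,u⟩ / ⟪σ⁴, [σ², u]⟫)`, a group surjecting onto `Heis V ⋊ ⟨S_m, U⟩`.
-/

set_option autoImplicit false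

noncomputable section

open Topology MeasureTheory
open scoped RealInnerProductSpace FourierTransform SchwartzMap

namespace HodgeCM
namespace SchwartzWeil

/-! ## 1. The parity operator and `𝓕² = P` -/

section Parity

variable (V : Type*) [NormedAddCommGroup V] [InnerProductSpace ℝ V]

/-- The parity operator `P : Φ ↦ Φ(-·)` on `𝓢(V, ℂ)`. -/
def parityCLM : 𝓢(V, ℂ) →L[ℂ] 𝓢(V, ℂ) :=
  SchwartzMap.compCLMOfContinuousLinearEquiv ℂ (ContinuousLinearEquiv.neg ℝ : V ≃L[ℝ] V)

/-- (Ported verbatim from the HodgeCMPerL package; no docstring in the source.) -/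
@[simp] theorem parityCLM_apply (Φ : 𝓢(V, ℂ)) (x : V) : parityCLM V Φ x = Φ (-x) := rfl

/-- (Ported verbatim from the HodgeCMPerL package; no docstring in the source.) -/
theorem parityCLM_parityCLM (Φ : 𝓢(V, ℂ)) : parityCLM V (parityCLM V Φ) = Φ := by
  ext x
  rw [parityCLM_apply, parityCLM_apply, neg_neg]

/-- (Ported verbatim from the HodgeCMPerL package; no docstring in the source.) -/
theorem parityCLM_comp_parityCLM : (parityCLM V).comp (parityCLM V) = ContinuousLinearMap.id ℂ 𝓢(V, ℂ) :=
  ContinuousLinearMap.ext (parityCLM_parityCLM V)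

/-- `P` commutes with every chirp (the chirp is even). -/
theorem parityCLM_chirpCLM (c : ℝ) (Φ : 𝓢(V, ℂ)) : parityCLM V (chirpCLM V c Φ) = chirpCLM V c (parityCLM V Φ) := by
  ext x
  rw [parityCLM_apply, chirpCLM_apply, chirpCLM_apply, parityCLM_apply, norm_neg]

end Parity

section Fourier

variable (V : Type) [NormedAddCommGroup V] [InnerProductSpace ℝ V] [FiniteDimensional ℝ V] [MeasurableSpace V]
  [BorelSpace V]

/-- **`𝓕(𝓕 Φ) = Φ(-·)`**: the relation `S² = P`. -/
theorem fourier_fourier_eq_parityCLM (Φ : 𝓢(V, ℂ)) : 𝓕 (𝓕 Φ) = parityCLM V Φ := by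
  ext x
  have h1 : (𝓕 (𝓕 Φ) : 𝓢(V, ℂ)) x = 𝓕 ((𝓕 Φ : 𝓢(V, ℂ)) : V → ℂ) x := rfl
  rw [h1, parityCLM_apply, ← neg_neg x, ← Real.fourierInv_eq_fourier_neg, neg_neg, ← SchwartzMap.fourierInv_coe,
    FourierTransform.fourierInv_fourier_eq]

/-- `𝓕 ∘ P = P ∘ 𝓕`. -/
theorem fourier_parityCLM (Φ : 𝓢(V, ℂ)) : 𝓕 (parityCLM V Φ) = parityCLM V (𝓕 Φ) := by
  rw [← fourier_fourier_eq_parityCLM, ← fourier_fourier_eq_parityCLM]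

/-- **`𝓕⁴ = id`**: the relation `S⁴ = 1`. -/
theorem fourier_fourier_fourier_fourier (Φ : 𝓢(V, ℂ)) : 𝓕 (𝓕 (𝓕 (𝓕 Φ))) = Φ := by
  rw [fourier_fourier_eq_parityCLM, fourier_fourier_eq_parityCLM, parityCLM_parityCLM]

/-- `𝓕² = P` as units. -/
theorem fourierUnit_sq_apply (Φ : 𝓢(V, ℂ)) :
    ((fourierUnit V ^ 2 : (𝓢(V, ℂ) →L[ℂ] 𝓢(V, ℂ))ˣ) : 𝓢(V, ℂ) →L[ℂ] 𝓢(V, ℂ)) Φ = parityCLM V Φ := by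
  rw [pow_two, Units.val_mul, mul_apply_eq_comp, fourierUnit_apply, fourierUnit_apply, fourier_fourier_eq_parityCLM]

/-- **`𝓕⁴ = 1` in `End(𝓢(V, ℂ))ˣ`.** -/
theorem fourierUnit_pow_four : (fourierUnit V ^ 4 : (𝓢(V, ℂ) →L[ℂ] 𝓢(V, ℂ))ˣ) = 1 := by
  refine Units.ext (ContinuousLinearMap.ext fun Φ => ?_)
  rw [show (4 : ℕ) = 2 + 2 from rfl, pow_add, Units.val_mul, mul_apply_eq_comp, fourierUnit_sq_apply,
    fourierUnit_sq_apply, parityCLM_parityCLM, Units.val_one, one_apply_eq_self]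

/-- `[𝓕², T_c] = 1` in `End(𝓢(V, ℂ))ˣ`. -/
theorem fourierUnit_sq_chirpUnit_comm (c : ℝ) :
    fourierUnit V ^ 2 * chirpUnit V c * (fourierUnit V ^ 2)⁻¹ * (chirpUnit V c)⁻¹ = 1 := by
  rw [mul_inv_eq_one, mul_inv_eq_iff_eq_mul]
  refine Units.ext (ContinuousLinearMap.ext fun Φ => ?_)
  rw [Units.val_mul, Units.val_mul, mul_apply_eq_comp, mul_apply_eq_comp, fourierUnit_sq_apply, chirpUnit_apply,
    chirpUnit_apply, fourierUnit_sq_apply, parityCLM_chirpCLM]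

end Fourier

/-! ## 2. The relations in `F⟨σ,u⟩`: `π(σ⁴) = 1`, `π([σ², u]) = 1` -/

section Words

/-- The word `σ⁴`. -/
def PsGen.weylPowFour : FreeGroup PsGen := FreeGroup.of PsGen.weyl ^ 4

/-- The word `[σ², u] = σ² u σ⁻² u⁻¹`. -/
def PsGen.commWeylSqUnip : FreeGroup PsGen :=
  FreeGroup.of PsGen.weyl ^ 2 * FreeGroup.of PsGen.unip * (FreeGroup.of PsGen.weyl ^ 2)⁻¹ * (FreeGroup.of PsGen.unip)⁻¹

variable (V : Type) [NormedAddCommGroup V] [InnerProductSpace ℝ V] [FiniteDimensional ℝ V] [MeasurableSpace V]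
  [BorelSpace V] (m : ℤ)

/-- **`π(σ⁴) = 1`.** -/
theorem psRep_weylPowFour : psRep V m PsGen.weylPowFour = 1 := by
  rw [PsGen.weylPowFour, map_pow, psRep_of, psGenUnit_weyl, fourierUnit_pow_four]

/-- **`π([σ², u]) = 1`.** -/
theorem psRep_commWeylSqUnip : psRep V m PsGen.commWeylSqUnip = 1 := by
  simp only [PsGen.commWeylSqUnip, map_mul, map_inv, map_pow, psRep_of, psGenUnit_weyl, psGenUnit_unip]
  exact fourierUnit_sq_chirpUnit_comm V m

end Words

/-! ## 3. The same relations on the Heisenberg side -/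

namespace Heis

variable {V : Type*} [NormedAddCommGroup V] [InnerProductSpace ℝ V] (m : ℤ) (hm : m ≠ 0)

/-- `σ²(a, b, u) = (-a, -b, u)`. -/
theorem weylAut_sq_apply (h : Heis V) : (weylAut m hm ^ 2) h = ⟨-h.a, -h.b, h.u⟩ := by
  rw [pow_two, MulAut.mul_apply, weylAut_apply, weylAut_apply, weyl_weyl]

/-- **`σ⁴ = 1` in `MulAut (Heis V)`.** -/
theorem weylAut_pow_four : weylAut (V := V) m hm ^ 4 = 1 := by
  ext h : 1
  rw [show (4 : ℕ) = 2 + 2 from rfl, pow_add, MulAut.mul_apply, weylAut_sq_apply, weylAut_sq_apply,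
    MulAut.one_apply, neg_neg, neg_neg]

/-- `σ²` commutes with every `u_t`. -/
theorem weylAut_sq_unip (t : ℝ) (h : Heis V) : (weylAut m hm ^ 2) (unip t h) = unip t ((weylAut m hm ^ 2) h) := by
  rw [weylAut_sq_apply, weylAut_sq_apply, unip_apply, unip_apply]
  ext
  · rfl
  · simp only [unipFun, smul_neg, neg_add]
  · simp only [unipFun, norm_neg]

/-- **`[σ², u_t] = 1` in `MulAut (Heis V)`.** -/
theorem weylAut_sq_unip_comm (t : ℝ) :
    weylAut (V := V) m hm ^ 2 * unip t * (weylAut m hm ^ 2)⁻¹ * (unip t)⁻¹ = 1 := by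
  rw [mul_inv_eq_one, mul_inv_eq_iff_eq_mul]
  ext h : 1
  rw [MulAut.mul_apply, MulAut.mul_apply, weylAut_sq_unip]

/-- **`ψ(σ⁴) = 1`.** -/
theorem psAction_weylPowFour : psAction (V := V) m hm PsGen.weylPowFour = 1 := by
  rw [PsGen.weylPowFour, map_pow, psAction_of, psGenAut_weyl, weylAut_pow_four]

/-- **`ψ([σ², u]) = 1`.** -/
theorem psAction_commWeylSqUnip : psAction (V := V) m hm PsGen.commWeylSqUnip = 1 := by
  simp only [PsGen.commWeylSqUnip, map_mul, map_inv, map_pow, psAction_of, psGenAut_weyl, psGenAut_unip]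
  exact weylAut_sq_unip_comm m hm 2

end Heis

/-! ## 4. Consequence: both words act trivially in the model of #12 -/

section Model

variable (V : Type) [NormedAddCommGroup V] [InnerProductSpace ℝ V] [FiniteDimensional ℝ V] [MeasurableSpace V]
  [BorelSpace V] (m : ℤ) (hm : m ≠ 0)

/-- **Projective shadow of ALL relations.**  A word `w ∈ F⟨σ,u⟩` that acts trivially on `Heis V` (i.e. a
relation of the matrix group `⟨S_m, U⟩`) acts on `𝓢(V, ℂ)` by an operator COMMUTING WITH `ρ_m(Heis V)` — the
formal residue of "the relation holds up to the metaplectic cocycle" (identifying that commutant with the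
scalars is the Stone–von Neumann / Weil-index computation not done here). -/
theorem psRep_comm_repUnits_of_psAction_eq_one {w : FreeGroup PsGen} (hw : Heis.psAction (V := V) m hm w = 1)
    (h : Heis V) : psRep V m w * repUnits V m h = repUnits V m h * psRep V m w := by
  have h1 := intertwines_psRep V m hm w h
  rw [hw, MulAut.one_apply] at h1
  calc psRep V m w * repUnits V m h
      = psRep V m w * repUnits V m h * (psRep V m w)⁻¹ * psRep V m w := by rw [inv_mul_cancel_right]
    _ = repUnits V m h * psRep V m w := by rw [← h1]

/-- (Ported verbatim from the HodgeCMPerL package; no docstring in the source.) -/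
theorem psRep_comm_repCLM_of_mem_ker_psAction {w : FreeGroup PsGen} (hw : w ∈ (Heis.psAction (V := V) m hm).ker)
    (h : Heis V) (Φ : 𝓢(V, ℂ)) :
    (psRep V m w : 𝓢(V, ℂ) →L[ℂ] 𝓢(V, ℂ)) (repCLM V m h Φ) =
      repCLM V m h ((psRep V m w : 𝓢(V, ℂ) →L[ℂ] 𝓢(V, ℂ)) Φ) := by
  have h1 := congrArg (fun u : (𝓢(V, ℂ) →L[ℂ] 𝓢(V, ℂ))ˣ => (u : 𝓢(V, ℂ) →L[ℂ] 𝓢(V, ℂ)) Φ)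
    (psRep_comm_repUnits_of_psAction_eq_one V m hm ((MonoidHom.mem_ker).mp hw) h)
  simpa only [Units.val_mul, mul_apply_eq_comp, val_repUnits] using h1

/-- The normal subgroup `⟪σ⁴, [σ², u]⟫ ⊴ F⟨σ,u⟩` of relations verified here. -/
def psRelations : Subgroup (FreeGroup PsGen) :=
  Subgroup.normalClosure {PsGen.weylPowFour, PsGen.commWeylSqUnip}

/-- (Ported verbatim from the HodgeCMPerL package; no docstring in the source.) -/
theorem psRelations_le_ker_psRep : psRelations ≤ (psRep V m).ker := by
  refine Subgroup.normalClosure_le_normal ?_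
  rintro w (rfl | rfl)
  · exact psRep_weylPowFour V m
  · exact psRep_commWeylSqUnip V m

omit [FiniteDimensional ℝ V] [MeasurableSpace V] [BorelSpace V] in
/-- (Ported verbatim from the HodgeCMPerL package; no docstring in the source.) -/
theorem psRelations_le_ker_psAction : psRelations ≤ (Heis.psAction (V := V) m hm).ker := by
  refine Subgroup.normalClosure_le_normal ?_
  rintro w (rfl | rfl)
  · exact Heis.psAction_weylPowFour m hm
  · exact Heis.psAction_commWeylSqUnip m hm

/-- **Every verified relation word acts trivially on `Heis V` and on `𝓢(V, ℂ)`**, so `(h, g) ↦ ρ_m(h) π_g`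
factors through `Heis V ⋊ (F⟨σ,u⟩ / ⟪σ⁴, [σ², u]⟫)`. -/
theorem repP_inr_eq_one_of_mem_psRelations {w : FreeGroup PsGen} (hw : w ∈ psRelations) :
    repP V m hm (SemidirectProduct.inr w) = 1 ∧ Heis.psAction (V := V) m hm w = 1 :=
  ⟨by rw [repP_def, repSD_inr]; exact psRelations_le_ker_psRep V m hw, psRelations_le_ker_psAction V m hm hw⟩

/-- In particular `ρ̃(x · w) = ρ̃(x)` for every relation word `w`. -/
theorem repP_mul_inr_of_mem_psRelations {w : FreeGroup PsGen} (hw : w ∈ psRelations) (x : HeisP V m hm) :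
    repP V m hm (x * SemidirectProduct.inr w) = repP V m hm x := by
  rw [map_mul, (repP_inr_eq_one_of_mem_psRelations V m hm hw).1, mul_one]

end Model

end SchwartzWeil
end HodgeCM
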